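import Literature.RepresentationTheory.Semisimple.MultiplicityDecomposition
import HarnessLib

/-!
# Realisation of a virtual representation of norm one by an irreducible representation
# (the Grothendieck-group step of Barnet-Lamb–Gee–Geraghty–Taylor 2014, § 5.5)

Topic `Literature/RepresentationTheory/Semisimple` (sequel to `Multiplicity`,
`MultiplicityDecomposition`; THEOREMS ONLY — no definition of mathematical content beyond two
bookkeeping linear equivalences, no named fact).

Barnet-Lamb, Gee, Geraghty and Taylor (*Potential automorphy and change of weight*, Ann. of
Math. 179 (2014), § 5.5, the "basic group theory" preamble = arXiv:1010.2561 § 5.4, pp. 38–39;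
numbering: the held text is the arXiv version, whose § 5.4 / Thm. 5.4.1 are § 5.5 / Thm. 5.5.1 of
the published paper) work in
the Grothendieck group `Gr_{F,l}` of the category of finite-dimensional semisimple continuous
representations of a group and record, verbatim: "There is a perfect symmetric `ℤ`-valued
pairing `( , )` on `Gr` defined by `([U],[V]) = dim Hom_G(U, V)`.  If `A = ∑ᵢ nᵢ [Vᵢ]` with the
`Vᵢ` irreducible and distinct then `(A, A) = ∑ᵢ nᵢ²`.  In particular if `A ∈ Gr` and
`dim A ≥ 0` and `(A, A) = 1` then `A = [V]` for some irreducible object `V`."  This is the step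
by which a virtual representation produced by Brauer induction is recognised to be (the class
of) a genuine irreducible representation (ibid., proof of Thm. 5.5.1; R. Taylor, *On the
meromorphic continuation of degree two L-functions*, Doc. Math. Extra Vol. Coates (2006),
proof of Thm. 6.6; L. Dieulefait, J. reine angew. Math. 577 (2004), Thm. 1.1).

This file proves that statement for representations of an arbitrary group `G` over an
algebraically closed field `k`, phrased WITHOUT a Grothendieck group: a virtual representation is
a finite family of finite-dimensional semisimple representations `ρᵢ` with integer
coefficients `nᵢ`, the pairing is `dim_k Hom_G` (Mathlib `Representation.IntertwiningMap`), and
"`A = [W]`" is rendered by the four additive invariants a consumer needs — `dim Hom_G(−, σ)`,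
`dim Hom_G(σ, −)`, the character, and the dimension:

* `Representation.IntertwiningMap.prodLeftLinearEquiv` —
  `Hom_G(ρ ⊕ σ, τ) ≃ Hom_G(ρ, τ) × Hom_G(σ, τ)` (the first-slot companion of the tree's
  `IntertwiningMap.prodLinearEquiv`);
* `Representation.exists_decomposition_sum` — a finite-dimensional semisimple `ρ` over an
  algebraically closed field has irreducible subrepresentations `T₁, …, Tₘ` with
  `dim ρ = ∑ dim Tᵢ`, `χ_ρ = ∑ χ_{Tᵢ}`, `dim Hom_G(ρ, σ) = ∑ dim Hom_G(Tᵢ, σ)` and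
  `dim Hom_G(σ, ρ) = ∑ dim Hom_G(σ, Tᵢ)` for every finite-dimensional `σ` (the additive form of
  `ρ ≃ ⊕ Tᵢ`; same induction as the tree's `Representation.exists_decomposition`);
* `Representation.finrank_intertwiningMap_eq_sum_sum` — the PAIRING FORMULA
  `dim Hom_G(ρ, ρ') = #{(i, i') | Tᵢ ≃ T'ᵢ'}` for two such decompositions (Schur);
* `Int.exists_eq_one_of_sum_sq_eq_one` — integers with `∑ cⱼ² = 1` are `±1` at one index and `0`
  elsewhere;
* `Representation.exists_irreducible_of_sum_pairing_eq_one` — **the realisation theorem**: if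
  `∑ᵢⱼ nᵢ nⱼ dim Hom_G(ρᵢ, ρⱼ) = 1` and `∑ᵢ nᵢ dim ρᵢ > 0`, there are an index `i₀` and an
  IRREDUCIBLE subrepresentation `W ≤ ρ_{i₀}` with `dim Hom_G(W, σ) = ∑ nᵢ dim Hom_G(ρᵢ, σ)`,
  `dim Hom_G(σ, W) = ∑ nᵢ dim Hom_G(σ, ρᵢ)` (all finite-dimensional `σ`), `χ_W = ∑ nᵢ χ_{ρᵢ}` and
  `dim W = ∑ nᵢ dim ρᵢ`.

Proof of the realisation theorem (ibid.): decompose every `ρᵢ` into irreducibles `T_{i,a}`;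
group the finitely many constituents into equivalence classes `κ` and put
`c_κ = ∑_{(i,a) ∈ κ} nᵢ`; by Schur the pairing hypothesis reads `∑_κ c_κ² = 1`, so exactly one
class `κ₀` has `c_{κ₀} = ±1`; the dimension hypothesis reads `c_{κ₀} dim κ₀ > 0`, so
`c_{κ₀} = 1`; every class-invariant additive quantity of `∑ nᵢ [ρᵢ]` then equals its value on a
representative `W` of `κ₀`.

Consumers: the Brauer-induction construction of compatible systems (the named facts
`TaylorDieulefait_potAutomorphic_mem_weaklyCompatibleSystem_GL2_rat` and
`BLGGT2014_thm551_compatibleSystem_rat_GL4` of `Literature.NumberTheory.Automorphic`).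

## References

* T. Barnet-Lamb, T. Gee, D. Geraghty, R. Taylor, *Potential automorphy and change of weight*,
  Ann. of Math. 179 (2014), § 5.5 (preamble) and proof of Thm. 5.5.1
  (= arXiv:1010.2561 § 5.4 and Thm. 5.4.1, pp. 38–40). [BarnetlambEtAl2014]
* C. W. Curtis, I. Reiner, *Representation Theory of Finite Groups and Associative Algebras*
  (1962), Ch. II (semisimple modules, Schur's lemma, uniqueness of the decomposition).
  [CurtisReiner1962]
* J.-P. Serre, *Linear Representations of Finite Groups*, GTM 42 (1977), § 2.3 and § 7.1–7.2
  (the scalar product of characters; virtual characters). [SerreLinearRepresentations1977]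
-/

noncomputable section

namespace Literature.RepresentationTheory.Semisimple

open scoped MonoidAlgebra
open Literature.RepresentationTheory.FiniteGroups Module

universe u v w w'

variable {k : Type u} [Field k] {G : Type v} [Group G]

/-! ### `Hom_G(ρ ⊕ σ, τ)` -/

section ProdLeft

variable {V : Type w} [AddCommGroup V] [Module k V] {W : Type w'} [AddCommGroup W] [Module k W]
  {X : Type*} [AddCommGroup X] [Module k X]

/-- **`Hom_G(ρ ⊕ σ, τ) ≃ Hom_G(ρ, τ) × Hom_G(σ, τ)`** (restriction to the two summands;
inverse `(f, g) ↦ f ∘ pr₁ + g ∘ pr₂`, Mathlib `LinearMap.coprod`). [folklore] -/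
def Representation.IntertwiningMap.prodLeftLinearEquiv (ρ : Representation k G V)
    (σ : Representation k G W) (τ : Representation k G X) :
    Representation.IntertwiningMap (ρ.prod σ) τ ≃ₗ[k]
      Representation.IntertwiningMap ρ τ × Representation.IntertwiningMap σ τ where
  toFun f := (f.comp (Representation.IntertwiningMap.inl k ρ σ),
    f.comp (Representation.IntertwiningMap.inr k ρ σ))
  invFun p := ⟨p.1.toLinearMap.coprod p.2.toLinearMap, fun g => LinearMap.ext fun v => by
    simp only [LinearMap.coe_comp, Function.comp_apply, Representation.prod_apply_apply,
      LinearMap.coprod_apply, Representation.IntertwiningMap.coe_toLinearMap, map_add,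
      Representation.IntertwiningMap.isIntertwining]⟩
  left_inv f := Representation.IntertwiningMap.ext (LinearMap.ext fun v => by
    change f ((v.1, (0 : W)) : V × W) + f (((0 : V), v.2) : V × W) = f v
    rw [← map_add, Prod.mk_add_mk, add_zero, zero_add])
  right_inv p := Prod.ext
    (Representation.IntertwiningMap.ext (LinearMap.ext fun v => by
      change p.1 v + p.2 (0 : W) = p.1 v
      rw [map_zero, add_zero]))
    (Representation.IntertwiningMap.ext (LinearMap.ext fun v => by
      change p.1 (0 : V) + p.2 v = p.2 v
      rw [map_zero, zero_add]))
  map_add' _ _ := rfl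
  map_smul' _ _ := rfl

/-- **Additivity of `dim Hom_G(−, τ)`**: `dim Hom_G(ρ ⊕ σ, τ) = dim Hom_G(ρ, τ) + dim Hom_G(σ, τ)`.
[folklore] -/
theorem Representation.finrank_intertwiningMap_prod_left [FiniteDimensional k V]
    [FiniteDimensional k W] [FiniteDimensional k X] (ρ : Representation k G V)
    (σ : Representation k G W) (τ : Representation k G X) :
    Module.finrank k (Representation.IntertwiningMap (ρ.prod σ) τ) =
      Module.finrank k (Representation.IntertwiningMap ρ τ) +
        Module.finrank k (Representation.IntertwiningMap σ τ) := by
  rw [(Representation.IntertwiningMap.prodLeftLinearEquiv ρ σ τ).finrank_eq, Module.finrank_prod]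

end ProdLeft

/-! ### Decomposition into irreducibles: the additive invariants -/

section Decomposition

/-- Induction carrier for `Representation.exists_decomposition_sum`. [folklore] -/
theorem Representation.exists_decomposition_sum_aux (n : ℕ) :
    ∀ {V : Type w} [AddCommGroup V] [Module k V] [FiniteDimensional k V]
      (ρ : Representation k G V) [ρ.IsSemisimpleRepresentation], Module.finrank k V ≤ n →
      ∃ (m : ℕ) (T : Fin m → Subrepresentation ρ),
        (∀ i, (T i).toRepresentation.IsIrreducible) ∧
        (Module.finrank k V = ∑ i, Module.finrank k (T i).toSubmodule) ∧
        (∀ g : G, ρ.character g = ∑ i, (T i).toRepresentation.character g) ∧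
        (∀ {X : Type w} [AddCommGroup X] [Module k X] [FiniteDimensional k X]
          (σ : Representation k G X),
          Module.finrank k (Representation.IntertwiningMap ρ σ) =
            ∑ i, Module.finrank k (Representation.IntertwiningMap (T i).toRepresentation σ)) ∧
        (∀ {X : Type w} [AddCommGroup X] [Module k X] [FiniteDimensional k X]
          (σ : Representation k G X),
          Module.finrank k (Representation.IntertwiningMap σ ρ) =
            ∑ i, Module.finrank k (Representation.IntertwiningMap σ (T i).toRepresentation)) := by
  induction n with
  | zero =>
    intro V _ _ _ ρ _ hV
    haveI : Subsingleton V := Module.finrank_zero_iff.mp (Nat.le_zero.mp hV)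
    refine ⟨0, Fin.elim0, fun i => Fin.elim0 i, ?_, ?_, ?_, ?_⟩
    · rw [Module.finrank_zero_of_subsingleton]
      simp
    · intro g
      simp [Representation.character, Subsingleton.elim (ρ g) 0]
    · intro X _ _ _ σ
      haveI : Subsingleton (Representation.IntertwiningMap ρ σ) :=
        ⟨fun f g => Representation.IntertwiningMap.ext (LinearMap.ext fun v => by
          rw [Subsingleton.elim v 0, map_zero, map_zero])⟩
      rw [Module.finrank_zero_of_subsingleton]
      simp
    · intro X _ _ _ σ
      rw [show Module.finrank k (Representation.IntertwiningMap σ ρ) = Representation.mult σ ρ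
        from rfl, Representation.mult_eq_zero_of_subsingleton]
      simp
  | succ n ih =>
    intro V _ _ _ ρ _ hV
    rcases subsingleton_or_nontrivial V with hV0 | hV0
    · exact ih ρ (by rw [Module.finrank_zero_of_subsingleton]; exact Nat.zero_le _)
    -- split off an irreducible subrepresentation `S` with complement `Q`
    obtain ⟨S, -, hS⟩ := Representation.exists_ne_bot_isIrreducible ρ
    haveI := hS
    obtain ⟨Q, hSQ⟩ := exists_isCompl S
    haveI : Q.toRepresentation.IsSemisimpleRepresentation :=
      Subrepresentation.isSemisimpleRepresentation_toRepresentation Q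
    haveI : Nontrivial S.toSubmodule :=
      Representation.nontrivial_of_isIrreducible S.toRepresentation
    have hdim := Subrepresentation.finrank_add_eq_of_isCompl hSQ
    have hSpos : 0 < Module.finrank k S.toSubmodule := Module.finrank_pos
    have hQn : Module.finrank k Q.toSubmodule ≤ n := by omega
    obtain ⟨m, T', hT'irr, hT'dim, hT'char, hT'left, hT'right⟩ := ih Q.toRepresentation hQn
    -- transport the constituents of `Q` into `ρ`
    let f : ∀ i, Representation.IntertwiningMap (T' i).toRepresentation ρ := fun i =>
      (Subrepresentation.subtypeIntertwiningMap Q).comp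
        (Subrepresentation.subtypeIntertwiningMap (T' i))
    have hf : ∀ i, Function.Injective (f i) := fun i x y hxy =>
      Subrepresentation.subtypeIntertwiningMap_injective (T' i)
        (Subrepresentation.subtypeIntertwiningMap_injective Q hxy)
    let ι : Fin m → Subrepresentation ρ := fun i => (f i).range
    have eι : ∀ i, Representation.Equiv (T' i).toRepresentation (ι i).toRepresentation :=
      fun i => Subrepresentation.equivRange (f i) (hf i)
    have hirr : ∀ i, ((Fin.cons S ι : Fin (m + 1) → Subrepresentation ρ) i)
        |>.toRepresentation.IsIrreducible := by
      intro i
      refine Fin.cases ?_ (fun i => ?_) i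
      · rw [Fin.cons_zero]; exact hS
      · rw [Fin.cons_succ]
        haveI := hT'irr i
        exact Representation.isIrreducible_of_equiv (eι i)
    have eSQ := Subrepresentation.prodEquivOfIsCompl ρ S Q hSQ
    refine ⟨m + 1, Fin.cons S ι, hirr, ?_, ?_, ?_, ?_⟩
    · -- dimension
      rw [Fin.sum_univ_succ, Fin.cons_zero, ← hdim, hT'dim]
      refine congrArg₂ (· + ·) rfl (Finset.sum_congr rfl fun i _ => ?_)
      rw [Fin.cons_succ]
      exact (eι i).toLinearEquiv.finrank_eq
    · -- character
      intro g
      rw [← Representation.char_iso eSQ, Representation.char_prod, Pi.add_apply, hT'char g,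
        Fin.sum_univ_succ, Fin.cons_zero]
      refine congrArg₂ (· + ·) rfl (Finset.sum_congr rfl fun i _ => ?_)
      rw [Fin.cons_succ, Representation.char_iso (eι i)]
    · -- `Hom_G(−, σ)`
      intro X _ _ _ σ
      rw [← (Representation.IntertwiningMap.congrLeft eSQ σ).finrank_eq,
        Representation.finrank_intertwiningMap_prod_left, hT'left σ, Fin.sum_univ_succ,
        Fin.cons_zero]
      refine congrArg₂ (· + ·) rfl (Finset.sum_congr rfl fun i _ => ?_)
      rw [Fin.cons_succ]
      exact (Representation.IntertwiningMap.congrLeft (eι i) σ).finrank_eq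
    · -- `Hom_G(σ, −)`
      intro X _ _ _ σ
      rw [← (Representation.IntertwiningMap.congrRight σ eSQ).finrank_eq,
        show Module.finrank k (Representation.IntertwiningMap σ
            (S.toRepresentation.prod Q.toRepresentation)) =
          Representation.mult σ (S.toRepresentation.prod Q.toRepresentation) from rfl,
        Representation.mult_prod, Representation.mult, Representation.mult, hT'right σ,
        Fin.sum_univ_succ, Fin.cons_zero]
      refine congrArg₂ (· + ·) rfl (Finset.sum_congr rfl fun i _ => ?_)
      rw [Fin.cons_succ]
      exact (Representation.IntertwiningMap.congrRight σ (eι i)).finrank_eq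

/-- **Decomposition into irreducibles, additive form.**  A finite-dimensional semisimple
representation `ρ` of a group over an algebraically closed field has irreducible
subrepresentations `T₁, …, Tₘ` such that `ρ ≃ ⊕ᵢ Tᵢ` in the sense that the four additive
invariants decompose: `dim ρ = ∑ dim Tᵢ`, `χ_ρ = ∑ χ_{Tᵢ}`, and for every finite-dimensional
`σ`, `dim Hom_G(ρ, σ) = ∑ dim Hom_G(Tᵢ, σ)` and `dim Hom_G(σ, ρ) = ∑ dim Hom_G(σ, Tᵢ)`.
(The multiplicity-count form is the tree's `Representation.exists_decomposition`; same proof,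
splitting off an irreducible subrepresentation and a complement.) [folklore] -/
theorem Representation.exists_decomposition_sum {V : Type w} [AddCommGroup V] [Module k V]
    [FiniteDimensional k V] (ρ : Representation k G V) [ρ.IsSemisimpleRepresentation] :
    ∃ (m : ℕ) (T : Fin m → Subrepresentation ρ),
      (∀ i, (T i).toRepresentation.IsIrreducible) ∧
      (Module.finrank k V = ∑ i, Module.finrank k (T i).toSubmodule) ∧
      (∀ g : G, ρ.character g = ∑ i, (T i).toRepresentation.character g) ∧
      (∀ {X : Type w} [AddCommGroup X] [Module k X] [FiniteDimensional k X]
        (σ : Representation k G X),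
        Module.finrank k (Representation.IntertwiningMap ρ σ) =
          ∑ i, Module.finrank k (Representation.IntertwiningMap (T i).toRepresentation σ)) ∧
      (∀ {X : Type w} [AddCommGroup X] [Module k X] [FiniteDimensional k X]
        (σ : Representation k G X),
        Module.finrank k (Representation.IntertwiningMap σ ρ) =
          ∑ i, Module.finrank k (Representation.IntertwiningMap σ (T i).toRepresentation)) :=
  Representation.exists_decomposition_sum_aux (Module.finrank k V) ρ le_rfl

open Classical in
/-- **The pairing formula** ([BLGGT] § 5.5 = arXiv § 5.4: "if `A = ∑ nᵢ[Vᵢ]` with the `Vᵢ`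
irreducible and distinct then `(A, A) = ∑ nᵢ²`", in the form needed here): for decompositions
`ρ ≃ ⊕ Tᵢ`,
`ρ' ≃ ⊕ T'ᵢ'` into irreducibles as in `Representation.exists_decomposition_sum`,
`dim Hom_G(ρ, ρ')` is the number of pairs `(i, i')` with `Tᵢ ≃ T'ᵢ'` (Schur's lemma,
`Representation.mult_eq_ite`).
[cite: BarnetlambEtAl2014, § 5.5 preamble (arXiv:1010.2561 § 5.4, p. 39)] -/
theorem Representation.finrank_intertwiningMap_eq_sum_sum [IsAlgClosed k] {V V' : Type w}
    [AddCommGroup V] [Module k V] [FiniteDimensional k V] [AddCommGroup V'] [Module k V']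
    [FiniteDimensional k V']
    {ρ : Representation k G V} {ρ' : Representation k G V'} {m m' : ℕ}
    {T : Fin m → Subrepresentation ρ} {T' : Fin m' → Subrepresentation ρ'}
    (hT : ∀ i, (T i).toRepresentation.IsIrreducible)
    (hT' : ∀ i', (T' i').toRepresentation.IsIrreducible)
    (hleft : ∀ {X : Type w} [AddCommGroup X] [Module k X] [FiniteDimensional k X]
      (σ : Representation k G X),
      Module.finrank k (Representation.IntertwiningMap ρ σ) =
        ∑ i, Module.finrank k (Representation.IntertwiningMap (T i).toRepresentation σ))
    (hright' : ∀ {X : Type w} [AddCommGroup X] [Module k X] [FiniteDimensional k X]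
      (σ : Representation k G X),
      Module.finrank k (Representation.IntertwiningMap σ ρ') =
        ∑ i', Module.finrank k (Representation.IntertwiningMap σ (T' i').toRepresentation)) :
    Module.finrank k (Representation.IntertwiningMap ρ ρ') =
      ∑ i, ∑ i', if Nonempty (Representation.Equiv (T i).toRepresentation
        (T' i').toRepresentation) then 1 else 0 := by
  rw [hleft ρ']
  refine Finset.sum_congr rfl fun i _ => ?_
  rw [hright' (T i).toRepresentation]
  refine Finset.sum_congr rfl fun i' _ => ?_
  haveI := hT i
  haveI := hT' i'
  exact Representation.mult_eq_ite

end Decomposition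

/-! ### Integers with `∑ cⱼ² = 1` -/

/-- Integers whose squares add up to `1` are `±1` at exactly one index and `0` elsewhere.
[folklore] -/
theorem Int.exists_eq_one_of_sum_sq_eq_one {κ : Type*} [Fintype κ] (c : κ → ℤ)
    (h : ∑ j, c j ^ 2 = 1) :
    ∃ j₀, (c j₀ = 1 ∨ c j₀ = -1) ∧ ∀ j, j ≠ j₀ → c j = 0 := by
  classical
  have hnonneg : ∀ j, 0 ≤ c j ^ 2 := fun j => sq_nonneg (c j)
  -- some `c j₀ ≠ 0`
  obtain ⟨j₀, hj₀⟩ : ∃ j₀, c j₀ ≠ 0 := by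
    by_contra hall
    simp only [not_exists, not_not] at hall
    have : ∑ j, c j ^ 2 = 0 := Finset.sum_eq_zero fun j _ => by rw [hall j]; ring
    omega
  have hsplit : ∑ j, c j ^ 2 = c j₀ ^ 2 + ∑ j ∈ Finset.univ.erase j₀, c j ^ 2 :=
    (Finset.add_sum_erase Finset.univ (fun j => c j ^ 2) (Finset.mem_univ j₀)).symm
  have hrest : 0 ≤ ∑ j ∈ Finset.univ.erase j₀, c j ^ 2 :=
    Finset.sum_nonneg fun j _ => hnonneg j
  have hsq1 : 1 ≤ c j₀ ^ 2 := by
    rcases lt_or_gt_of_ne hj₀ with hlt | hgt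
    · nlinarith
    · nlinarith
  have hsq : c j₀ ^ 2 = 1 := by omega
  have hrest0 : ∑ j ∈ Finset.univ.erase j₀, c j ^ 2 = 0 := by omega
  refine ⟨j₀, ?_, fun j hj => ?_⟩
  · have : (c j₀ - 1) * (c j₀ + 1) = 0 := by ring_nf; omega
    rcases mul_eq_zero.mp this with h1 | h1
    · left; omega
    · right; omega
  · have hle := (Finset.sum_eq_zero_iff_of_nonneg fun j _ => hnonneg j).mp hrest0 j
      (Finset.mem_erase.mpr ⟨hj, Finset.mem_univ j⟩)
    exact pow_eq_zero_iff two_ne_zero |>.mp hle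


/-! ### Summation over the classes of a finite set -/

/-- Bookkeeping: a sum `∑ₚ nₚ φ(p)` over a finite set, with `φ` constant on the fibres of a map
`cl : P → κ` with a section `out`, equals `∑ₓ (∑_{cl p = x} nₚ) φ(out x)`. [folklore] -/
theorem sum_cast_mul_eq_sum_fiber {P : Type*} [Fintype P] {κ : Type*} [Fintype κ]
    [DecidableEq κ] (cl : P → κ) (out : κ → P) (hout : ∀ x, cl (out x) = x)
    {M : Type*} [CommRing M] (n' : P → ℤ) (φ : P → M)
    (hφ : ∀ p q, cl p = cl q → φ p = φ q) :
    ∑ p, (n' p : M) * φ p =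
      ∑ x, ((∑ p ∈ Finset.univ.filter (fun p => cl p = x), n' p : ℤ) : M) * φ (out x) := by
  rw [← Finset.sum_fiberwise Finset.univ cl (fun p => (n' p : M) * φ p)]
  refine Finset.sum_congr rfl fun x _ => ?_
  rw [Int.cast_sum, Finset.sum_mul]
  refine Finset.sum_congr rfl fun p hp => ?_
  rw [hφ p (out x) (by rw [hout]; exact (Finset.mem_filter.mp hp).2)]

/-! ### The realisation theorem -/

section Realisation

variable [IsAlgClosed k] {ι : Type*} [Fintype ι] {V : ι → Type w} [∀ i, AddCommGroup (V i)]
  [∀ i, Module k (V i)] [∀ i, FiniteDimensional k (V i)]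

/-- **Realisation of a virtual representation of norm one** (Barnet-Lamb–Gee–Geraghty–Taylor
2014, § 5.5 = arXiv § 5.4: "if `A ∈ Gr_{F,l}` and `dim A ≥ 0` and `(A, A) = 1` then `A = [V]`
for some irreducible object `V`").  Let `ρᵢ` (`i ∈ ι`, finite) be finite-dimensional semisimple
representations of a group `G` over an algebraically closed field `k` and `nᵢ ∈ ℤ`, and consider
the virtual representation `A = ∑ nᵢ [ρᵢ]`.  If `(A, A) = ∑ᵢⱼ nᵢ nⱼ dim_k Hom_G(ρᵢ, ρⱼ) = 1` and
`dim A = ∑ nᵢ dim ρᵢ > 0`, then `A` is the class of an irreducible representation: there are an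
index `i₀` and an IRREDUCIBLE subrepresentation `W` of `ρ_{i₀}` such that, for every
finite-dimensional representation `σ`, `dim Hom_G(W, σ) = ∑ nᵢ dim Hom_G(ρᵢ, σ)` and
`dim Hom_G(σ, W) = ∑ nᵢ dim Hom_G(σ, ρᵢ)`, the character of `W` is `∑ nᵢ χ_{ρᵢ}`, and
`dim W = ∑ nᵢ dim ρᵢ`. [cite: BarnetlambEtAl2014, § 5.5 preamble (arXiv:1010.2561 § 5.4, p. 39)] -/
theorem Representation.exists_irreducible_of_sum_pairing_eq_one
    (ρ : ∀ i, Representation k G (V i)) [∀ i, (ρ i).IsSemisimpleRepresentation] (n : ι → ℤ)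
    (hpair : ∑ i, ∑ j, n i * n j *
      (Module.finrank k (Representation.IntertwiningMap (ρ i) (ρ j)) : ℤ) = 1)
    (hdim : 0 < ∑ i, n i * (Module.finrank k (V i) : ℤ)) :
    ∃ (i₀ : ι) (W : Subrepresentation (ρ i₀)),
      W.toRepresentation.IsIrreducible ∧
      (∀ {X : Type w} [AddCommGroup X] [Module k X] [FiniteDimensional k X]
        (σ : Representation k G X),
        (Module.finrank k (Representation.IntertwiningMap W.toRepresentation σ) : ℤ) =
          ∑ i, n i * (Module.finrank k (Representation.IntertwiningMap (ρ i) σ) : ℤ)) ∧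
      (∀ {X : Type w} [AddCommGroup X] [Module k X] [FiniteDimensional k X]
        (σ : Representation k G X),
        (Module.finrank k (Representation.IntertwiningMap σ W.toRepresentation) : ℤ) =
          ∑ i, n i * (Module.finrank k (Representation.IntertwiningMap σ (ρ i)) : ℤ)) ∧
      (∀ g : G, W.toRepresentation.character g = ∑ i, (n i : k) * (ρ i).character g) ∧
      ((Module.finrank k W.toSubmodule : ℤ) = ∑ i, n i * (Module.finrank k (V i) : ℤ)) := by
  classical
  -- Step 0: decompose every `ρ i` into irreducibles `T i a`, `a : Fin (m i)`.
  have hdec := fun i => Representation.exists_decomposition_sum (ρ i)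
  choose m T hTirr hTdim hTchar hTleft hTright using hdec
  -- the finite set `P` of all constituents, the equivalence relation "equivalent", its classes
  let P := Σ i, Fin (m i)
  let r : P → P → Prop := fun p q =>
    Nonempty (Representation.Equiv (T p.1 p.2).toRepresentation (T q.1 q.2).toRepresentation)
  have hr : Equivalence r :=
    ⟨fun p => ⟨Representation.Equiv.refl _⟩, fun ⟨e⟩ => ⟨e.symm⟩, fun ⟨e⟩ ⟨e'⟩ => ⟨e.trans e'⟩⟩
  letI PS : Setoid P := ⟨r, hr⟩
  let cl : P → Quotient PS := fun p => Quotient.mk PS p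
  have hcl : ∀ p q : P, cl p = cl q ↔ r p q := fun p q => by
    constructor
    · intro h; exact Quotient.exact h
    · intro h; exact Quotient.sound h
  have hout : ∀ x : Quotient PS, cl x.out = x := fun x => Quotient.out_eq x
  let n' : P → ℤ := fun p => n p.1
  let c : Quotient PS → ℤ := fun x => ∑ p ∈ Finset.univ.filter (fun p => cl p = x), n' p
  -- KEY bookkeeping: a class function `φ` integrates against `n'` class by class.
  have key : ∀ {M : Type u} [CommRing M] (φ : P → M), (∀ p q, r p q → φ p = φ q) →
      ∑ p, (n' p : M) * φ p = ∑ x, (c x : M) * φ x.out := fun {M} _ φ hφ =>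
    sum_cast_mul_eq_sum_fiber cl Quotient.out hout n' φ fun p q h => hφ p q ((hcl p q).mp h)
  have keyℤ : ∀ (φ : P → ℤ), (∀ p q, r p q → φ p = φ q) →
      ∑ p, n' p * φ p = ∑ x, c x * φ x.out := fun φ hφ => by
    have h := sum_cast_mul_eq_sum_fiber cl Quotient.out hout n' φ
      fun p q h => hφ p q ((hcl p q).mp h)
    simpa only [Int.cast_id] using h
  -- Step 1: the pairing hypothesis reads `∑ₓ c_x² = 1`.
  have h1 : ∀ i j, (Module.finrank k (Representation.IntertwiningMap (ρ i) (ρ j)) : ℤ) =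
      ∑ a, ∑ b, (if Nonempty (Representation.Equiv (T i a).toRepresentation
        (T j b).toRepresentation) then 1 else 0 : ℤ) := by
    intro i j
    rw [Representation.finrank_intertwiningMap_eq_sum_sum (hTirr i) (hTirr j) (hTleft i)
      (hTright j)]
    push_cast
    rfl
  have hpairP : ∑ p : P, ∑ q : P, n' p * n' q * (if r p q then 1 else 0) = 1 := by
    refine Eq.trans ?_ hpair
    simp_rw [h1, Finset.mul_sum]
    rw [Fintype.sum_sigma]
    refine Finset.sum_congr rfl fun i _ => ?_
    refine (Finset.sum_congr rfl fun a _ => by rw [Fintype.sum_sigma]).trans ?_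
    rw [Finset.sum_comm]
  have h2 : ∀ p : P, ∑ q, n' p * n' q * (if r p q then 1 else 0) = n' p * c (cl p) := by
    intro p
    rw [show c (cl p) = ∑ q ∈ Finset.univ.filter (fun q => cl q = cl p), n' q from rfl,
      Finset.sum_filter, Finset.mul_sum]
    refine Finset.sum_congr rfl fun q _ => ?_
    by_cases h : r p q
    · rw [if_pos h, if_pos ((hcl q p).mpr (hr.symm h)), mul_one]
    · rw [if_neg h, if_neg (fun h' => h (hr.symm ((hcl q p).mp h'))), mul_zero, mul_zero]
  have hsumsq : ∑ x : Quotient PS, c x ^ 2 = 1 := by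
    rw [← hpairP]
    simp_rw [h2]
    rw [keyℤ (fun p => c (cl p)) (fun p q hpq => by rw [(hcl p q).mpr hpq])]
    refine Finset.sum_congr rfl fun x _ => ?_
    rw [hout, sq]
  -- Step 2: exactly one class `x₀` has `c x₀ = ±1`; the dimension hypothesis forces `+1`.
  obtain ⟨x₀, hx₀, hc0⟩ := Int.exists_eq_one_of_sum_sq_eq_one c hsumsq
  let d : P → ℤ := fun p => (Module.finrank k (T p.1 p.2).toSubmodule : ℤ)
  have hd : ∀ p q, r p q → d p = d q := fun p q ⟨e⟩ => by
    change (Module.finrank k (T p.1 p.2).toSubmodule : ℤ) = Module.finrank k (T q.1 q.2).toSubmodule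
    exact_mod_cast e.toLinearEquiv.finrank_eq
  have hdimP : ∑ i, n i * (Module.finrank k (V i) : ℤ) = c x₀ * d x₀.out := by
    have hA : ∑ i, n i * (Module.finrank k (V i) : ℤ) = ∑ p, n' p * d p := by
      rw [Fintype.sum_sigma]
      refine Finset.sum_congr rfl fun i _ => ?_
      rw [hTdim i]
      push_cast
      rw [Finset.mul_sum]
    rw [hA, keyℤ d hd, Finset.sum_eq_single x₀ (fun x _ hx => by rw [hc0 x hx, zero_mul])
      (fun h => absurd (Finset.mem_univ x₀) h)]
  have hc1 : c x₀ = 1 := by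
    rcases hx₀ with h | h
    · exact h
    · exfalso
      have hdnn : 0 ≤ d x₀.out := Int.natCast_nonneg _
      rw [hdimP, h] at hdim
      linarith
  -- evaluation of class functions against the virtual representation
  have eval : ∀ {M : Type u} [CommRing M] (φ : P → M), (∀ p q, r p q → φ p = φ q) →
      ∑ p, (n' p : M) * φ p = φ x₀.out := by
    intro M _ φ hφ
    rw [key φ hφ, Finset.sum_eq_single x₀ (fun x _ hx => by rw [hc0 x hx, Int.cast_zero, zero_mul])
      (fun h => absurd (Finset.mem_univ x₀) h), hc1, Int.cast_one, one_mul]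
  have evalℤ : ∀ (φ : P → ℤ), (∀ p q, r p q → φ p = φ q) → ∑ p, n' p * φ p = φ x₀.out := by
    intro φ hφ
    rw [keyℤ φ hφ, Finset.sum_eq_single x₀ (fun x _ hx => by rw [hc0 x hx, zero_mul])
      (fun h => absurd (Finset.mem_univ x₀) h), hc1, one_mul]
  -- Step 3: `W := T_{p₀}` for the representative `p₀` of `x₀`.
  refine ⟨x₀.out.1, T x₀.out.1 x₀.out.2, hTirr _ _, ?_, ?_, ?_, ?_⟩
  · intro X _ _ _ σ
    let φ : P → ℤ := fun p =>
      (Module.finrank k (Representation.IntertwiningMap (T p.1 p.2).toRepresentation σ) : ℤ)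
    have hφ : ∀ p q, r p q → φ p = φ q := fun p q ⟨e⟩ => by
      change (Module.finrank k (Representation.IntertwiningMap (T p.1 p.2).toRepresentation σ) : ℤ)
        = Module.finrank k (Representation.IntertwiningMap (T q.1 q.2).toRepresentation σ)
      exact_mod_cast (Representation.IntertwiningMap.congrLeft e σ).finrank_eq
    have hB : ∑ i, n i * (Module.finrank k (Representation.IntertwiningMap (ρ i) σ) : ℤ) =
        ∑ p, n' p * φ p := by
      rw [Fintype.sum_sigma]
      refine Finset.sum_congr rfl fun i _ => ?_
      rw [hTleft i σ]
      push_cast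
      rw [Finset.mul_sum]
    rw [hB, evalℤ φ hφ]
  · intro X _ _ _ σ
    let φ : P → ℤ := fun p =>
      (Module.finrank k (Representation.IntertwiningMap σ (T p.1 p.2).toRepresentation) : ℤ)
    have hφ : ∀ p q, r p q → φ p = φ q := fun p q ⟨e⟩ => by
      change (Module.finrank k (Representation.IntertwiningMap σ (T p.1 p.2).toRepresentation) : ℤ)
        = Module.finrank k (Representation.IntertwiningMap σ (T q.1 q.2).toRepresentation)
      exact_mod_cast (Representation.IntertwiningMap.congrRight σ e).finrank_eq
    have hB : ∑ i, n i * (Module.finrank k (Representation.IntertwiningMap σ (ρ i)) : ℤ) =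
        ∑ p, n' p * φ p := by
      rw [Fintype.sum_sigma]
      refine Finset.sum_congr rfl fun i _ => ?_
      rw [hTright i σ]
      push_cast
      rw [Finset.mul_sum]
    rw [hB, evalℤ φ hφ]
  · intro g
    let φ : P → k := fun p => (T p.1 p.2).toRepresentation.character g
    have hφ : ∀ p q, r p q → φ p = φ q := fun p q ⟨e⟩ => by
      change (T p.1 p.2).toRepresentation.character g = (T q.1 q.2).toRepresentation.character g
      rw [Representation.char_iso e]
    have hB : ∑ i, (n i : k) * (ρ i).character g = ∑ p, (n' p : k) * φ p := by
      rw [Fintype.sum_sigma]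
      refine Finset.sum_congr rfl fun i _ => ?_
      rw [hTchar i g, Finset.mul_sum]
    rw [hB, eval φ hφ]
  · rw [hdimP, hc1, one_mul]

end Realisation

end Literature.RepresentationTheory.Semisimple
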